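import Literature.Computability.QuantumComplexity.HadamardSandwich
import HarnessLib

/-!
# The Hadamard-sandwich block encoding, II: entries as averages over the averaging register

Topic `Literature/Computability/QuantumComplexity`; sequel of `HadamardSandwich.lean`, a step in the
discharge of `ajl_jonesApproxProblem_mem_PromiseBQP`. With the Hadamard wires `ws = c :: as`
(`c` the column ancilla, `as` the `k` averaging wires) the block formula
`hadSandwich_cnot_phase_apply` is re-indexed by the *number* `n < 2^k` written on `as`:

* `filter_fibreOff_cons`: the labels of the fibre of `z` off `c :: as` with prescribed bit `b` on `c`
  form the fibre of `z[c ↦ b]` off `as`;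
* `writeNat as z n` (write the bits of `n` on the wires `as`), `sum_fibreOff_eq_sum_range`
  (`Σ_{y ∈ fibre} F y = Σ_{n < 2^k} F (writeNat as z n)`);
* **`sandwich_entry`**: for `x`, `z` clean on `ws`,
  `W x z = [z ≡ x off t :: ws] · (1/2)^{k+1} · Σ_{n < 2^k} i^{g (writeNat as (z[c ↦ x_t ⊕ z_t]) n)}`;
* **`sandwich_entry_sign`**: if on these labels `g = 2·[σ n]` for a Boolean `σ`, the sum is
  `2^k − 2·#{n < 2^k | σ n}`, so `2·W x z = [⋯]·(1 − 2·#{σ}/2^k)` — the form matched against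
  `DyadicThresholds.card_filter_lt_real`.

## References

* D. W. Berry, A. M. Childs, R. Cleve, R. Kothari, R. D. Somma, *Exponential improvement in precision
  for simulating sparse Hamiltonians*, STOC 2014, §3 (Lemma 3.1 ff.: implementing linear
  combinations by Hadamard-conjugated controlled phases) [BerryEtAl2014].
* M. A. Nielsen, I. L. Chuang, *Quantum Computation and Quantum Information*, CUP 2010, §1.4.4,
  §6.1.1 [NielsenChuang2010].
-/

noncomputable section

namespace Literature.Computability.QuantumComplexity

open Matrix Finset Cryptography

variable {N : ℕ}

/-! ### Fibres off `c :: as` with the bit on `c` prescribed -/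

/-- Prescribing the bit on the first wire cuts the fibre down to a fibre off the remaining wires.
[folklore] -/
theorem filter_fibreOff_cons {c : Fin N} {as : List (Fin N)} (hc : c ∉ as) (z : QReg N) (b : Bool) :
    (fibreOff (c :: as) z).filter (fun y => y c = b) = fibreOff as (Function.update z c b) := by
  ext y
  rw [Finset.mem_filter, mem_fibreOff, mem_fibreOff, eqOff_cons_iff]
  constructor
  · rintro ⟨h, hb⟩; rwa [hb] at h
  · intro h
    have hb : y c = b := by have := h c hc; rwa [Function.update_self] at this
    exact ⟨by rwa [hb], hb⟩

/-! ### Writing a number on a list of wires -/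

/-- Write the bits of `n` on the wires `as` (wire `as[j]` gets bit `j`), keep `z` elsewhere. [folklore] -/
def writeNat : List (Fin N) → QReg N → ℕ → QReg N
  | [], z, _ => z
  | a :: as, z, n => writeNat as (Function.update z a (n.testBit 0)) (n / 2)

/-- Writing does not touch wires off the list. [folklore] -/
theorem writeNat_apply_of_not_mem : ∀ (as : List (Fin N)) (z : QReg N) (n : ℕ) {j : Fin N}, j ∉ as → writeNat as z n j = z j
  | [], _, _, _, _ => rfl
  | a :: as, z, n, j, hj => by
    simp only [List.mem_cons, not_or] at hj
    rw [writeNat, writeNat_apply_of_not_mem as _ _ hj.2, Function.update_of_ne hj.1]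

/-- The written label lies in the fibre. [folklore] -/
theorem writeNat_mem_fibreOff (as : List (Fin N)) (z : QReg N) (n : ℕ) : writeNat as z n ∈ fibreOff as z :=
  mem_fibreOff.2 fun _ hj => writeNat_apply_of_not_mem as z n hj

/-- The bits written (distinct wires): wire `as[j]` carries bit `j` of `n`. [folklore] -/
theorem writeNat_getElem : ∀ (as : List (Fin N)) (_ : as.Nodup) (z : QReg N) (n : ℕ) (j : ℕ) (hj : j < as.length),
    writeNat as z n (as[j]) = n.testBit j
  | [], _, _, _, j, hj => by simp at hj
  | a :: as, hnd, z, n, 0, _ => by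
    have ha : a ∉ as := (List.nodup_cons.1 hnd).1
    rw [List.getElem_cons_zero, writeNat, writeNat_apply_of_not_mem as _ _ ha, Function.update_self]
  | a :: as, hnd, z, n, j + 1, hj => by
    rw [List.getElem_cons_succ, writeNat, writeNat_getElem as (List.nodup_cons.1 hnd).2 _ _ j (by simpa using hj),
      Nat.testBit_div_two]

/-- Writing the number read off a label of the fibre gives the label back. [folklore] -/
theorem writeNat_eq_of_mem_fibreOff : ∀ (as : List (Fin N)) (_ : as.Nodup) (z y : QReg N), y ∈ fibreOff as z →
    ∃ n, n < 2 ^ as.length ∧ writeNat as z n = y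
  | [], _, z, y, hy => ⟨0, by simp, by
      rw [mem_fibreOff] at hy; exact (funext fun j => (hy j (by simp)).symm : z = y) ▸ rfl⟩
  | a :: as, hnd, z, y, hy => by
    have ha : a ∉ as := (List.nodup_cons.1 hnd).1
    rw [mem_fibreOff, eqOff_cons_iff, ← mem_fibreOff] at hy
    obtain ⟨n, hn, hw⟩ := writeNat_eq_of_mem_fibreOff as (List.nodup_cons.1 hnd).2 _ y hy
    refine ⟨2 * n + (y a).toNat, by simp [List.length_cons, pow_succ]; cases y a <;> simp <;> omega, ?_⟩
    rw [writeNat]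
    have e1 : (2 * n + (y a).toNat).testBit 0 = y a := by cases y a <;> simp [Nat.testBit_zero, Nat.mul_mod_right]
    have e2 : (2 * n + (y a).toNat) / 2 = n := by cases y a <;> simp; omega
    rw [e1, e2, hw]

/-- Writing is injective on `n < 2^{|as|}`. [folklore] -/
theorem writeNat_injOn (as : List (Fin N)) (hnd : as.Nodup) (z : QReg N) {n n' : ℕ} (hn : n < 2 ^ as.length)
    (hn' : n' < 2 ^ as.length) (h : writeNat as z n = writeNat as z n') : n = n' := by
  apply Nat.eq_of_testBit_eq
  intro j
  by_cases hj : j < as.length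
  · rw [← writeNat_getElem as hnd z n j hj, ← writeNat_getElem as hnd z n' j hj, h]
  · push Not at hj
    have h2 : 2 ^ as.length ≤ 2 ^ j := Nat.pow_le_pow_right (by norm_num) hj
    rw [Nat.testBit_lt_two_pow (lt_of_lt_of_le hn h2), Nat.testBit_lt_two_pow (lt_of_lt_of_le hn' h2)]

/-- **Re-indexing a fibre sum by the number written on the wires.** [folklore] -/
theorem sum_fibreOff_eq_sum_range {M : Type*} [AddCommMonoid M] (as : List (Fin N)) (hnd : as.Nodup) (z : QReg N) (F : QReg N → M) :
    ∑ y ∈ fibreOff as z, F y = ∑ n ∈ Finset.range (2 ^ as.length), F (writeNat as z n) := by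
  have himg : fibreOff as z = (Finset.range (2 ^ as.length)).image (writeNat as z) := by
    ext y
    rw [Finset.mem_image]
    constructor
    · intro hy
      obtain ⟨n, hn, rfl⟩ := writeNat_eq_of_mem_fibreOff as hnd z y hy
      exact ⟨n, Finset.mem_range.2 hn, rfl⟩
    · rintro ⟨n, -, rfl⟩; exact writeNat_mem_fibreOff as z n
  rw [himg, Finset.sum_image]
  intro n hn n' hn' h
  exact writeNat_injOn as hnd z (Finset.mem_range.1 hn) (Finset.mem_range.1 hn') h

/-! ### The entries of the sandwich as sums over `n < 2^k` -/

/-- **Entries of the Hadamard sandwich** `W = L_rev · (CNOT_{c→t} · diag(i^g)) · L` between labels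
clean on the Hadamard wires `c :: as`: zero unless `z ≡ x` off `t :: c :: as`, and then
`(1/2)^{k+1} Σ_{n < 2^k} i^{g(z[c ↦ x_t ⊕ z_t][as ↦ n])}`. [cite: BerryEtAl2014, §3] -/
theorem sandwich_entry {c t : Fin N} {as : List (Fin N)} (hnd : (c :: as).Nodup) (ht : t ∉ c :: as) (hct : c ≠ t)
    (g : QReg N → ℕ) {x z : QReg N} (hx : ∀ i ∈ c :: as, x i = false) (hz : ∀ i ∈ c :: as, z i = false) :
    (hadLayerRev (c :: as) * ((cnotOn c t hct).toMatrix 0 * phaseDiag g) * hadLayer (c :: as)) x z =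
      if EqOff (t :: c :: as) z x then
        ((1 / 2 : ℝ) : ℂ) ^ (as.length + 1) *
          ∑ n ∈ Finset.range (2 ^ as.length), Complex.I ^ g (writeNat as (Function.update z c (x t ^^ z t)) n)
      else 0 := by
  rw [hadSandwich_cnot_phase_apply hnd ht hct g hx hz, filter_fibreOff_cons (List.nodup_cons.1 hnd).1,
    sum_fibreOff_eq_sum_range as (List.nodup_cons.1 hnd).2, List.length_cons]

/-- **Sign sums**: `Σ_{n < 2^k} i^{2[σ n]} = 2^k − 2·#{n < 2^k | σ n}`. [folklore] -/
theorem sum_I_pow_two_mul_toNat (k : ℕ) (σ : ℕ → Bool) :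
    ∑ n ∈ Finset.range (2 ^ k), Complex.I ^ (2 * (σ n).toNat) =
      (2 ^ k : ℂ) - 2 * (((Finset.range (2 ^ k)).filter fun n => σ n = true).card : ℂ) := by
  have hpt : ∀ n, Complex.I ^ (2 * (σ n).toNat) = 1 - 2 * (if σ n = true then (1 : ℂ) else 0) := by
    intro n; cases σ n <;> simp [Complex.I_sq]; norm_num
  simp_rw [hpt]
  rw [Finset.sum_sub_distrib, ← Finset.mul_sum, Finset.sum_boole, Finset.sum_const, Finset.card_range]
  simp

/-- **Entries of the sandwich for a sign predicate**: if on the labels summed over the exponent is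
`2·[σ n]`, then `2 · W x z = [z ≡ x off t :: c :: as] · (1 − 2·#{n < 2^k | σ n}/2^k)`.
[cite: BerryEtAl2014, §3] -/
theorem two_mul_sandwich_entry_of_sign {c t : Fin N} {as : List (Fin N)} (hnd : (c :: as).Nodup) (ht : t ∉ c :: as) (hct : c ≠ t)
    (g : QReg N → ℕ) {x z : QReg N} (hx : ∀ i ∈ c :: as, x i = false) (hz : ∀ i ∈ c :: as, z i = false)
    (σ : ℕ → Bool) (hg : ∀ n, n < 2 ^ as.length → g (writeNat as (Function.update z c (x t ^^ z t)) n) = 2 * (σ n).toNat) :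
    2 * (hadLayerRev (c :: as) * ((cnotOn c t hct).toMatrix 0 * phaseDiag g) * hadLayer (c :: as)) x z =
      if EqOff (t :: c :: as) z x then
        (1 : ℂ) - 2 * (((Finset.range (2 ^ as.length)).filter fun n => σ n = true).card : ℂ) / 2 ^ as.length
      else 0 := by
  rw [sandwich_entry hnd ht hct g hx hz]
  split_ifs with h
  · rw [Finset.sum_congr rfl fun n hn => by rw [hg n (Finset.mem_range.1 hn)], sum_I_pow_two_mul_toNat]
    have h2 : (2 : ℂ) ^ as.length ≠ 0 := pow_ne_zero _ two_ne_zero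
    have hhalf : ((1 / 2 : ℝ) : ℂ) ^ (as.length + 1) = ((2 : ℂ) ^ as.length)⁻¹ / 2 := by
      push_cast; rw [pow_succ, one_div, inv_pow]; ring
    rw [hhalf]
    field_simp
  · simp

end Literature.Computability.QuantumComplexity

end
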